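import Mathlib
import HarnessLib
import Summits.MatrixMultiplication.MatrixMultiplication.Theorems.OutsiderSandwichEdgeRigidity
import Summits.MatrixMultiplication.MatrixMultiplication.Theorems.OutsiderSandwichTouchingExponent

/-!
# OutsiderSandwich — EDGE RIGIDITY of the Strassen body, II: the uniform edge gap; minimal
counterexamples are interior (decomp-mm lens 4, gen 14, part 2 of 2)

Part 1 (`OutsiderSandwichEdgeRigidity`): a universal spectral point with an extremal side value
(`F⟨2,1,1⟩ = 2 ∨ F⟨1,2,1⟩ = 2 ∨ F⟨1,1,2⟩ = 2`) has `F⟨2,2,2⟩ = 4` (Schönhage non-additivity).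
Here: by COMPACTNESS of the spectrum (gen 13, `exists_universal_clusterPt`, `le_of_mapClusterPt`)
the law is uniform — for every `τ₀ > 2` there is `δ > 0` with all three side values `≤ 2 − δ` at every
universal point with `τ_F = log₂ F⟨2,2,2⟩ ≥ τ₀` (§4) — and the LENS-4 READINGS for the cut of record
`closes : LaserTangency → LaserMergeOptimal → SummitIffLaserTangency → ω = 2` (rev 18, unchanged):
every counterexample to the attacked crux `LaserTangency` — in particular gen 13's EXTREMAL touching
point (`τ_F = τ* = sup T > 2`) — and, in a world with `ω > 2`, every TOP point and every witness of
the residual `LaserMergeOptimal`, is an INTERIOR point of the Strassen body (all side values `< 2`);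
on the three edges the only contact with the laser floor `x = log₂3 + (τ−2)/3` is the gauge corner
`F(cw₂) = 3` (§5).  §6 proves the route item `EdgeRigidity` (aside, rank 9) by name.

Sources: Strassen1988 (Thm. 2.3); AlmanLiPratt2026 (Prop. 8.1); Schonhage1981;
BurgisserClausenShokrollahi1997 ((15.12)); CoppersmithWinograd1990 (§6); ChristandlVranaZuiddam2023.
-/

set_option linter.dupNamespace false

namespace Summit.MatrixMultiplication.MatrixMultiplication.Theorems.OutsiderSandwichEdgeGap

open scoped BigOperators
open Filter Topology
open Literature.Computability.AlgebraicComplexity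
open Summit.MatrixMultiplication.MatrixMultiplication.Theses.OutsiderSandwich
  (LaserTangency LaserMergeOptimal)
open Summit.MatrixMultiplication.MatrixMultiplication.Theorems.OutsiderSandwichLaserFloor
  (one_le_map_matMulTensor)
open Summit.MatrixMultiplication.MatrixMultiplication.Theorems.OutsiderSandwichLaserClassBlocks
  (side_le_two)
open Summit.MatrixMultiplication.MatrixMultiplication.Theorems.OutsiderSandwichTouchingPoints
  (exists_universal_clusterPt le_of_mapClusterPt)
open Summit.MatrixMultiplication.MatrixMultiplication.Theorems.OutsiderSandwichTouchingExponent
  (touchingExponents exists_extremal_touching laserMergeOptimal_iff_omega_mem)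
open Summit.MatrixMultiplication.MatrixMultiplication.Theorems.OutsiderSandwichEdgeRigidity
  (map_matMulTensor_two_eq_four_of_side matExp_eq_two_of_side sides_lt_two_of_two_lt_matExp)

/-! ## 4. The uniform edge gap (compactness of the spectrum) -/

/-- One side at a time: for `τ₀ > 2` there is `δ > 0` such that every universal point with
`τ_F ≥ τ₀` has `F(s) ≤ 2 − δ`, for any tensor `s` with `F(s) ≤ 2` always and `F(s) = 2 ⟹ F⟨2,2,2⟩ = 4`
(a sequence of universal points with `F_n(s) → 2` has a universal cluster point with `F(s) = 2` and
`τ_F ≥ τ₀ > 2`). [cite: Strassen1988, Thm. 2.3] -/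
theorem exists_gap_of_rigid {τ₀ : ℝ} (hτ₀ : 2 < τ₀) {ι κ μ : Type} [Fintype ι] [Fintype κ] [Fintype μ]
    (s : ι → κ → μ → ℂ)
    (hle : ∀ G : SpectralMap ℂ, IsUniversalSpectralPoint ℂ G → G s ≤ 2)
    (hrig : ∀ G : SpectralMap ℂ, IsUniversalSpectralPoint ℂ G → G s = 2 → G (matMulTensor ℂ 2 2 2) = 4) :
    ∃ δ : ℝ, 0 < δ ∧ ∀ G : SpectralMap ℂ, IsUniversalSpectralPoint ℂ G →
      τ₀ ≤ Real.logb 2 (G (matMulTensor ℂ 2 2 2)) → G s ≤ 2 - δ := by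
  by_contra hcon
  push Not at hcon
  choose G hG using fun n : ℕ => hcon (1 / ((n : ℝ) + 1)) (by positivity)
  obtain ⟨φ, -, hc, hU⟩ := exists_universal_clusterPt G (fun n => (hG n).1)
  -- `2 ≤ φ[s]`
  have h1 : (2 : ℝ) ≤ φ (TensorClass.mk s) := by
    refine le_of_mapClusterPt hc isClosed_univ (fun _ => Set.mem_univ _) continuousOn_const
      (continuous_apply (TensorClass.mk s)).continuousOn fun n => ?_
    show (2 : ℝ) ≤ TensorClass.eval (G n) (TensorClass.mk s) + 1 / ((n : ℝ) + 1)
    rw [TensorClass.eval_mk (hG n).1]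
    linarith [(hG n).2.2]
  -- `2^τ₀ ≤ φ[⟨2,2,2⟩]`
  have h2 : (2 : ℝ) ^ τ₀ ≤ φ (TensorClass.mk (matMulTensor ℂ 2 2 2)) := by
    refine le_of_mapClusterPt hc isClosed_univ (fun _ => Set.mem_univ _) continuousOn_const
      (continuous_apply (TensorClass.mk (matMulTensor ℂ 2 2 2))).continuousOn fun n => ?_
    show (2 : ℝ) ^ τ₀ ≤ TensorClass.eval (G n) (TensorClass.mk (matMulTensor ℂ 2 2 2)) + 1 / ((n : ℝ) + 1)
    rw [TensorClass.eval_mk (hG n).1]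
    have hpos : 0 < G n (matMulTensor ℂ 2 2 2) :=
      lt_of_lt_of_le one_pos (one_le_map_matMulTensor (hG n).1 (by norm_num))
    have h3 : (2 : ℝ) ^ τ₀ ≤ G n (matMulTensor ℂ 2 2 2) := by
      calc (2 : ℝ) ^ τ₀ ≤ (2 : ℝ) ^ Real.logb 2 (G n (matMulTensor ℂ 2 2 2)) :=
            Real.rpow_le_rpow_of_exponent_le one_le_two (hG n).2.1
        _ = G n (matMulTensor ℂ 2 2 2) := Real.rpow_logb two_pos (by norm_num) hpos
    have h4 : (0 : ℝ) < 1 / ((n : ℝ) + 1) := by positivity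
    linarith
  -- the cluster point as a universal spectral point
  have eS : TensorClass.spectralMapOf φ s = φ (TensorClass.mk s) := TensorClass.spectralMapOf_apply φ s
  have eM : TensorClass.spectralMapOf φ (matMulTensor ℂ 2 2 2) = φ (TensorClass.mk (matMulTensor ℂ 2 2 2)) :=
    TensorClass.spectralMapOf_apply φ _
  have hs2 : TensorClass.spectralMapOf φ s = 2 := le_antisymm (hle _ hU) (by rw [eS]; exact h1)
  have h4 := hrig _ hU hs2
  rw [eM] at h4
  rw [h4] at h2
  have h5 : (2 : ℝ) ^ τ₀ ≤ (2 : ℝ) ^ (2 : ℝ) := by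
    calc (2 : ℝ) ^ τ₀ ≤ 4 := h2
      _ = (2 : ℝ) ^ (2 : ℝ) := by norm_num
  have h6 := (Real.rpow_le_rpow_left_iff one_lt_two).1 h5
  linarith

/-- **UNIFORM EDGE GAP**: for every `τ₀ > 2` there is `δ > 0` such that every universal spectral point
with `τ_F ≥ τ₀` has all three side values `≤ 2 − δ` (edge rigidity + compactness of the spectrum).
[cite: Strassen1988, Thm. 2.3] -/
theorem uniform_edge_gap {τ₀ : ℝ} (hτ₀ : 2 < τ₀) :
    ∃ δ : ℝ, 0 < δ ∧ ∀ G : SpectralMap ℂ, IsUniversalSpectralPoint ℂ G →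
      τ₀ ≤ Real.logb 2 (G (matMulTensor ℂ 2 2 2)) →
        G (matMulTensor ℂ 2 1 1) ≤ 2 - δ ∧ G (matMulTensor ℂ 1 2 1) ≤ 2 - δ ∧
          G (matMulTensor ℂ 1 1 2) ≤ 2 - δ := by
  obtain ⟨δ₁, hδ₁, h₁⟩ := exists_gap_of_rigid hτ₀ (matMulTensor ℂ 2 1 1)
    (fun G hG => (side_le_two hG).1) (fun G hG h => map_matMulTensor_two_eq_four_of_side hG (Or.inl h))
  obtain ⟨δ₂, hδ₂, h₂⟩ := exists_gap_of_rigid hτ₀ (matMulTensor ℂ 1 2 1)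
    (fun G hG => (side_le_two hG).2.1)
    (fun G hG h => map_matMulTensor_two_eq_four_of_side hG (Or.inr (Or.inl h)))
  obtain ⟨δ₃, hδ₃, h₃⟩ := exists_gap_of_rigid hτ₀ (matMulTensor ℂ 1 1 2)
    (fun G hG => (side_le_two hG).2.2)
    (fun G hG h => map_matMulTensor_two_eq_four_of_side hG (Or.inr (Or.inr h)))
  refine ⟨min δ₁ (min δ₂ δ₃), lt_min hδ₁ (lt_min hδ₂ hδ₃), fun G hG hτ => ⟨?_, ?_, ?_⟩⟩
  · have := h₁ G hG hτ
    have := min_le_left δ₁ (min δ₂ δ₃)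
    linarith
  · have := h₂ G hG hτ
    have := (min_le_right δ₁ (min δ₂ δ₃)).trans (min_le_left δ₂ δ₃)
    linarith
  · have := h₃ G hG hτ
    have := (min_le_right δ₁ (min δ₂ δ₃)).trans (min_le_right δ₂ δ₃)
    linarith

/-! ## 5. Lens-4 readings: the minimal counterexample is interior -/

/-- **The extremal touching point is interior.**  If the attacked crux `LaserTangency` FAILS, the
maximal counterexample of gen 13 — a universal point ON the laser floor with `τ_F = τ* = sup T > 2`
— has all three side values `< 2`: it lies on none of the three edges of the Strassen body.
[cite: Strassen1988, Thm. 2.3] -/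
theorem extremal_touching_interior (h : ¬ LaserTangency) :
    ∃ F : SpectralMap ℂ, IsUniversalSpectralPoint ℂ F ∧
      Real.logb 2 (F (matMulTensor ℂ 2 2 2)) = sSup touchingExponents ∧
      Real.logb 2 (F (cwTensor ℂ 2)) = Real.logb 2 3 + (Real.logb 2 (F (matMulTensor ℂ 2 2 2)) - 2) / 3 ∧
      2 < Real.logb 2 (F (matMulTensor ℂ 2 2 2)) ∧
      F (matMulTensor ℂ 2 1 1) < 2 ∧ F (matMulTensor ℂ 1 2 1) < 2 ∧ F (matMulTensor ℂ 1 1 2) < 2 := by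
  obtain ⟨F, hF, hτ, hx, h2, -⟩ := exists_extremal_touching h
  exact ⟨F, hF, hτ, hx, h2, sides_lt_two_of_two_lt_matExp hF h2⟩

/-- **Every counterexample to the attacked crux is interior**: a touching point with `τ_F > 2` has all
side values `< 2`. -/
theorem touching_interior {F : SpectralMap ℂ} (hF : IsUniversalSpectralPoint ℂ F)
    (_hx : Real.logb 2 (F (cwTensor ℂ 2)) = Real.logb 2 3 + (Real.logb 2 (F (matMulTensor ℂ 2 2 2)) - 2) / 3)
    (hτ : 2 < Real.logb 2 (F (matMulTensor ℂ 2 2 2))) :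
    F (matMulTensor ℂ 2 1 1) < 2 ∧ F (matMulTensor ℂ 1 2 1) < 2 ∧ F (matMulTensor ℂ 1 1 2) < 2 :=
  sides_lt_two_of_two_lt_matExp hF hτ

/-- **On the edges the only touching is at the gauge corner**: a universal point with an extremal side
value touches the laser floor iff `F(cw₂) = 3`. [cite: CoppersmithWinograd1990, §6] -/
theorem edge_touching_iff_corner {F : SpectralMap ℂ} (hF : IsUniversalSpectralPoint ℂ F)
    (h : F (matMulTensor ℂ 2 1 1) = 2 ∨ F (matMulTensor ℂ 1 2 1) = 2 ∨ F (matMulTensor ℂ 1 1 2) = 2) :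
    Real.logb 2 (F (cwTensor ℂ 2)) = Real.logb 2 3 + (Real.logb 2 (F (matMulTensor ℂ 2 2 2)) - 2) / 3 ↔
      F (cwTensor ℂ 2) = 3 := by
  rw [matExp_eq_two_of_side hF h, sub_self, zero_div, add_zero]
  have h3 : 0 < F (cwTensor ℂ 2) := lt_of_lt_of_le (by norm_num)
    (Summit.MatrixMultiplication.MatrixMultiplication.Theorems.OutsiderSandwichLaserFloorCut.three_le_map_cwTensor hF)
  constructor
  · intro hlog
    have e1 := Real.rpow_logb two_pos (by norm_num) h3
    rw [hlog, Real.rpow_logb two_pos (by norm_num) (by norm_num : (0:ℝ) < 3)] at e1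
    exact e1.symm
  · intro h3'
    rw [h3']

/-- **In a world with `ω > 2`, every TOP point is interior** (`τ_F = ω > 2`). -/
theorem top_interior_of_not_summit (hS : ¬ _root_.MatrixMultiplication) {F : SpectralMap ℂ}
    (hF : IsUniversalSpectralPoint ℂ F) (htop : Real.logb 2 (F (matMulTensor ℂ 2 2 2)) = omega ℂ) :
    F (matMulTensor ℂ 2 1 1) < 2 ∧ F (matMulTensor ℂ 1 2 1) < 2 ∧ F (matMulTensor ℂ 1 1 2) < 2 := by
  have hω : 2 < omega ℂ := lt_of_le_of_ne (omega_two_le ℂ) (fun h => hS h.symm)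
  exact sides_lt_two_of_two_lt_matExp hF (htop ▸ hω)

/-- **The residual's witness is interior** (if it is not the summit itself): if `LaserMergeOptimal`
holds and `ω > 2`, the top corner `(ω, Λ(ω))` is carried by a universal point with all side values
`< 2`. -/
theorem laserMergeOptimal_witness_interior (hS : ¬ _root_.MatrixMultiplication) (h : LaserMergeOptimal) :
    ∃ F : SpectralMap ℂ, IsUniversalSpectralPoint ℂ F ∧
      Real.logb 2 (F (matMulTensor ℂ 2 2 2)) = omega ℂ ∧
      Real.logb 2 (F (cwTensor ℂ 2)) = Real.logb 2 3 + (omega ℂ - 2) / 3 ∧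
      F (matMulTensor ℂ 2 1 1) < 2 ∧ F (matMulTensor ℂ 1 2 1) < 2 ∧ F (matMulTensor ℂ 1 1 2) < 2 := by
  obtain ⟨F, hF, hτ, hx⟩ := laserMergeOptimal_iff_omega_mem.1 h
  exact ⟨F, hF, hτ, hx, top_interior_of_not_summit hS hF hτ⟩

/-! ## 6. Route item `EdgeRigidity` (aside, rank 9) by name -/

/-- **Route item `EdgeRigidity`** (aside, rank 9; edge rigidity ∧ uniform edge gap) holds.
[cite: AlmanLiPratt2026, Proposition 8.1] [cite: BurgisserClausenShokrollahi1997, (15.12)] -/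
theorem edgeRigidity_holds :
    Summit.MatrixMultiplication.MatrixMultiplication.Theses.OutsiderSandwich.EdgeRigidity :=
  ⟨fun _ hF h => map_matMulTensor_two_eq_four_of_side hF h, fun _ hτ₀ => uniform_edge_gap hτ₀⟩

end Summit.MatrixMultiplication.MatrixMultiplication.Theorems.OutsiderSandwichEdgeGap
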